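import Summits.QuantumAdvantage.QuantumAdvantage.Theorems.CubicForrelationNearExactIsExactFourteenSecondLevelSixBalanced
import Summits.QuantumAdvantage.QuantumAdvantage.Theorems.CubicForrelationNearExactIsExactFourteenSecondTypeOLowRank
import Summits.QuantumAdvantage.QuantumAdvantage.Theorems.CubicForrelationNearExactIsExactFourteenBoundary

/-!
# Crux `CubicForrelation.NearExactIsExact` (stmt-QuantumAdvantage-14043) — n = 14 at the SECOND boundary `15/16`:
  the STRUCTURE of a hypothetical cubic pair with `15/16 ≤ Φ < 1` (what the killed branches leave)

Certificate seat `b2b-cforr-cert` (gen 9).  HONEST FRAMING: a theorem about cubic Boolean pairs on 14 bits — the certified SEARCH SPACE for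
the open question `θ₁₄ < 15/16` (the `n ≡ 2 (mod 6)` instance of the second dyadic boundary; the tree has `θ₁₄ ∈ [57/64, 31/32)`,
`theta_fourteen_halfopen`) — NOT summit progress, and NOT a proof of `θ₁₄ < 15/16`.

With `W_g = 32·u_g`, `W_f = 32·u_f` (Ax) and the constant parities (`fd_parity_const`), the branches killed so far are:
level `≥ 7` non-bent (`fo_levelSeven`), level 6 with a balanced parity (`fo_levelSix_balanced_false`), and type O with a first digit of
rank `≤ 2` and `E = {d₁ = d₂} ≠ ∅` (`fo_lowrank_false`).  Hence (`fo_second_structure`): if cubic `f, g : 𝔽₂¹⁴ → 𝔽₂` have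
`15/16 ≤ Φ(f,g) < 1`, then one of
* `g` is BENT and `Φ = 15/16` exactly (dual distance `2⁹`), or the same for `f`;
* `g` is at level 6 (`W_g = 64u'`, some `u'` odd) with `2¹² ≤ #{u' odd} < 2¹³` (`fo_levelSix_card`), or the same for `f`;
* both are of type O, and on EACH side the first digit `d₁ = [⌊u/2⌋ odd]` has a radical of size `< 2¹²` (rank `≥ 4`) or the set
  `{d₁ = d₂}` is empty (`u ≡ ±3 (mod 8)` everywhere, "case A").
The paper analysis of the remaining branches is in the seat notes (rank `≥ 6` is tight on every rank-6 coset by the minimum weight `8` of the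
coset `ω⁽²⁾ + RM(3,6)`; case A reduces two-sidedly to two residual shapes).

References: J. Ax (1964) / R. J. McEliece (1972); X.-D. Hou (1998); MacWilliams–Sloane (1977) Ch. 13–15.  Everything below is proved from
Mathlib and the tree; axioms are the standard three.
-/

set_option linter.dupNamespace false -- D-0017: single-problem summit ⇒ `QuantumAdvantage.QuantumAdvantage` by design

noncomputable section

namespace Summit.QuantumAdvantage.QuantumAdvantage.Theorems.CubicForrelation.NearExactIsExact

open Finset
open Literature.Computability.QuantumComplexity
open Literature.Computability.QuantumComplexity.BuzetChailloux (bxor zeroVec)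
open Literature.Computability.QuantumComplexity.DerivativeWalsh (W)
open Summit.QuantumAdvantage.QuantumAdvantage.Theorems.SignedCubicForrelationNotPrBPP.Negative.HalfQuad (forrelation_comm)

/-- **The level-6 window.** For cubic `f, g` on 14 bits with `W_g = 64·u'`, some `u'(x)` odd and `Φ(f,g) ≥ 15/16`: the odd set of `u'` has
`2¹² ≤ #{u' odd} < 2¹³` (Reed–Muller for the quadratic parity; the two-sided budget `Σ(u' − 2s)² ≤ 2¹³` with cost `≥ 1` per odd point;
`fo_levelSix_balanced_false` excludes equality).  Finite-slice statement; NOT summit progress. [this work] -/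
theorem fo_levelSix_card (f g : (Fin (7 + 7) → Bool) → Bool) (hf : IsDegLeFun 3 f) (hg : IsDegLeFun 3 g)
    (u' : (Fin (7 + 7) → Bool) → ℤ) (hu' : ∀ x, W (fun y => signOf (g y)) x = (2 : ℝ) ^ 6 * (u' x : ℝ))
    (hodd : ∃ x, Odd (u' x)) (hΦ : (15 / 16 : ℝ) ≤ forrelation f g) :
    4096 ≤ #(univ.filter fun x : Fin (7 + 7) → Bool => Odd (u' x)) ∧
      #(univ.filter fun x : Fin (7 + 7) → Bool => Odd (u' x)) < 8192 := by
  classical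
  have hp : IsDegLeFun 2 (fun x => decide (Odd (u' x))) :=
    stub_walshTower stub_axParity (7 + 7) 6 2 g u' hg hu' (by intro k hk hkn; omega)
  obtain ⟨x₁, hx₁⟩ := hodd
  have hfilt : (univ.filter fun x : Fin (7 + 7) → Bool => decide (Odd (u' x)) = true) =
      univ.filter (fun x : Fin (7 + 7) → Bool => Odd (u' x)) := filter_congr fun x _ => by simp
  have hRM := bb_rmWeight_holds (7 + 7) 2 (fun x => decide (Odd (u' x))) hp ⟨x₁, by simpa using hx₁⟩
  rw [hfilt] at hRM
  refine ⟨by norm_num at hRM; omega, ?_⟩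
  -- the budget bounds the odd set by `2¹³`
  have hbud := fl_budget6 f g u' hu'
  have hB : (∑ x, (u' x - 2 * sZ (f x)) ^ 2 : ℤ) ≤ 8192 := by
    have h' : ((∑ x, (u' x - 2 * sZ (f x)) ^ 2 : ℤ) : ℝ) ≤ 8192 := by rw [hbud]; nlinarith
    exact_mod_cast h'
  have hsumP : (∑ x, (if Odd (u' x) then 1 else 0 : ℤ)) = #(univ.filter fun x : Fin (7 + 7) → Bool => Odd (u' x)) := by
    rw [sum_boole]
  have hpt : ∀ x, (if Odd (u' x) then 1 else 0 : ℤ) ≤ (u' x - 2 * sZ (f x)) ^ 2 := by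
    intro x
    by_cases h : Odd (u' x)
    · rw [if_pos h]
      have hodd' : Odd (u' x - 2 * sZ (f x)) := Int.odd_sub.2 (iff_of_true h (even_two_mul _))
      have h0 := Int.odd_iff.1 hodd'
      have : u' x - 2 * sZ (f x) ≤ -1 ∨ 1 ≤ u' x - 2 * sZ (f x) := by omega
      have := tp_sq_ge (k := 1) (by norm_num) this
      linarith
    · rw [if_neg h]; exact sq_nonneg _
  have hle : (#(univ.filter fun x : Fin (7 + 7) → Bool => Odd (u' x)) : ℤ) ≤ 8192 := by
    rw [← hsumP]; exact (sum_le_sum fun x _ => hpt x).trans hB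
  have hle' : #(univ.filter fun x : Fin (7 + 7) → Bool => Odd (u' x)) ≤ 8192 := by exact_mod_cast hle
  have hne : #(univ.filter fun x : Fin (7 + 7) → Bool => Odd (u' x)) ≠ 8192 :=
    fun h => fo_levelSix_balanced_false f g hf hg u' hu' h hΦ
  omega

/-- **Structure at the second boundary on 14 bits.**  If cubic `f, g : 𝔽₂¹⁴ → 𝔽₂` satisfy `15/16 ≤ Φ(f,g)` and `Φ(f,g) ≠ 1`, then
(writing `W_g = 32u_g`, `W_f = 32u_f`):  `g` is bent with `Φ = 15/16`;  or `f` is bent with `Φ = 15/16`;  or `g` is at level 6 with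
`2¹² ≤ #{W_g/64 odd} < 2¹³`;  or `f` is;  or both spectra are of type O (`u` odd everywhere) and on each side the radical of the first digit
`d₁ = [⌊u/2⌋ odd]` has fewer than `2¹²` elements or `[⌊u/2⌋ odd] ≠ [⌊u/4⌋ odd]` everywhere (case A).  This is the residual case list for
`θ₁₄ < 15/16` after `fo_levelSeven`, `fo_levelSix_balanced_false` and `fo_lowrank_false`; NOT a proof of `θ₁₄ < 15/16`, NOT summit
progress. [this work] -/
theorem fo_second_structure (f g : (Fin (7 + 7) → Bool) → Bool) (hf : IsDegLeFun 3 f) (hg : IsDegLeFun 3 g)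
    (hΦ : (15 / 16 : ℝ) ≤ forrelation f g) (hne : forrelation f g ≠ 1) :
    ((∀ x, W (fun y => signOf (g y)) x ^ 2 = (2 : ℝ) ^ (7 + 7)) ∧ forrelation f g = 15 / 16) ∨
    ((∀ y, W (fun x => signOf (f x)) y ^ 2 = (2 : ℝ) ^ (7 + 7)) ∧ forrelation f g = 15 / 16) ∨
    (∃ u' : (Fin (7 + 7) → Bool) → ℤ, (∀ x, W (fun y => signOf (g y)) x = (2 : ℝ) ^ 6 * (u' x : ℝ)) ∧
      4096 ≤ #(univ.filter fun x : Fin (7 + 7) → Bool => Odd (u' x)) ∧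
      #(univ.filter fun x : Fin (7 + 7) → Bool => Odd (u' x)) < 8192) ∨
    (∃ v' : (Fin (7 + 7) → Bool) → ℤ, (∀ y, W (fun x => signOf (f x)) y = (2 : ℝ) ^ 6 * (v' y : ℝ)) ∧
      4096 ≤ #(univ.filter fun y : Fin (7 + 7) → Bool => Odd (v' y)) ∧
      #(univ.filter fun y : Fin (7 + 7) → Bool => Odd (v' y)) < 8192) ∨
    (∃ u v : (Fin (7 + 7) → Bool) → ℤ, (∀ x, W (fun y => signOf (g y)) x = (2 : ℝ) ^ 5 * (u x : ℝ)) ∧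
      (∀ y, W (fun x => signOf (f x)) y = (2 : ℝ) ^ 5 * (v y : ℝ)) ∧ (∀ x, Odd (u x)) ∧ (∀ y, Odd (v y)) ∧
      (#(univ.filter fun a : Fin (7 + 7) → Bool => ∀ b, (decide (Odd (u zeroVec / 2)) ^^ decide (Odd (u a / 2)) ^^
          decide (Odd (u b / 2)) ^^ decide (Odd (u (bxor a b) / 2))) = false) < 2 ^ 12 ∨
        ∀ x, ¬ (Odd (u x / 2) ↔ Odd (u x / 2 / 2))) ∧
      (#(univ.filter fun a : Fin (7 + 7) → Bool => ∀ b, (decide (Odd (v zeroVec / 2)) ^^ decide (Odd (v a / 2)) ^^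
          decide (Odd (v b / 2)) ^^ decide (Odd (v (bxor a b) / 2))) = false) < 2 ^ 12 ∨
        ∀ y, ¬ (Odd (v y / 2) ↔ Odd (v y / 2 / 2)))) := by
  classical
  obtain ⟨ug, hug⟩ := tw_base g hg 5 (by norm_num)
  obtain ⟨uf, huf⟩ := tw_base f hf 5 (by norm_num)
  have hΦ' : (15 / 16 : ℝ) ≤ forrelation g f := by rw [forrelation_comm]; exact hΦ
  have hne' : forrelation g f ≠ 1 := by rw [forrelation_comm]; exact hne
  -- the residual alternative on one type-O side
  have hside : ∀ (f₁ g₁ : (Fin (7 + 7) → Bool) → Bool), IsDegLeFun 3 g₁ → (15 / 16 : ℝ) ≤ forrelation f₁ g₁ →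
      ∀ u : (Fin (7 + 7) → Bool) → ℤ, (∀ x, W (fun y => signOf (g₁ y)) x = (2 : ℝ) ^ 5 * (u x : ℝ)) → (∀ x, Odd (u x)) →
      (#(univ.filter fun a : Fin (7 + 7) → Bool => ∀ b, (decide (Odd (u zeroVec / 2)) ^^ decide (Odd (u a / 2)) ^^
          decide (Odd (u b / 2)) ^^ decide (Odd (u (bxor a b) / 2))) = false) < 2 ^ 12 ∨
        ∀ x, ¬ (Odd (u x / 2) ↔ Odd (u x / 2 / 2))) := by
    intro f₁ g₁ hg₁ hΦ₁ u hu hodd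
    by_contra h
    push Not at h
    obtain ⟨hR, x, hx⟩ := h
    exact fo_lowrank_false f₁ g₁ hg₁ u hu hodd hR ⟨x, hx⟩ hΦ₁
  -- an even side is at level 6 (proper) or at level `≥ 7`
  have heven : ∀ (f₁ g₁ : (Fin (7 + 7) → Bool) → Bool), IsDegLeFun 3 f₁ → IsDegLeFun 3 g₁ → (15 / 16 : ℝ) ≤ forrelation f₁ g₁ →
      forrelation f₁ g₁ ≠ 1 →
      ∀ u : (Fin (7 + 7) → Bool) → ℤ, (∀ x, W (fun y => signOf (g₁ y)) x = (2 : ℝ) ^ 5 * (u x : ℝ)) → (∃ x, ¬ Odd (u x)) →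
      ((∀ x, W (fun y => signOf (g₁ y)) x ^ 2 = (2 : ℝ) ^ (7 + 7)) ∧ forrelation f₁ g₁ = 15 / 16) ∨
      (∃ u' : (Fin (7 + 7) → Bool) → ℤ, (∀ x, W (fun y => signOf (g₁ y)) x = (2 : ℝ) ^ 6 * (u' x : ℝ)) ∧
        4096 ≤ #(univ.filter fun x : Fin (7 + 7) → Bool => Odd (u' x)) ∧
        #(univ.filter fun x : Fin (7 + 7) → Bool => Odd (u' x)) < 8192) := by
    intro f₁ g₁ hf₁ hg₁ hΦ₁ hne₁ u hu ⟨x₀, hx₀⟩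
    have hev : ∀ x, ¬ Odd (u x) := fun x h => hx₀ ((fd_parity_const g₁ u hg₁ hu x x₀).1 h)
    have hu6 := tw_level_up g₁ u hu hev
    by_cases h6 : ∃ x, Odd (u x / 2)
    · exact Or.inr ⟨fun x => u x / 2, hu6, fo_levelSix_card f₁ g₁ hf₁ hg₁ _ hu6 h6 hΦ₁⟩
    · push Not at h6
      have hu7 := tw_level_up g₁ (fun x => u x / 2) hu6 h6
      rcases fo_levelSeven f₁ g₁ hf₁ hg₁ _ hu7 hΦ₁ with h | h
      · exact absurd h hne₁
      · exact Or.inl h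
  by_cases hog : ∀ x, Odd (ug x)
  · by_cases hof : ∀ y, Odd (uf y)
    · -- both type O
      right; right; right; right
      exact ⟨ug, uf, hug, huf, hog, hof, hside f g hg hΦ ug hug hog, hside g f hf hΦ' uf huf hof⟩
    · push Not at hof
      rcases heven g f hg hf hΦ' hne' uf huf hof with h | h
      · right; left
        exact ⟨h.1, by rw [forrelation_comm]; exact h.2⟩
      · right; right; right; left
        exact h
  · push Not at hog
    rcases heven f g hf hg hΦ hne ug hug hog with h | h
    · left; exact h
    · right; right; left; exact h

/-- **The same structure at the literal type `Fin 14`** (for citation next to `theta_fourteen_halfopen`): a cubic pair on 14 bits with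
`15/16 ≤ Φ < 1` has a bent side at exactly `15/16`, or a side at level 6 with an odd set of size in `[2¹², 2¹³)`, or two type-O sides
each of first-digit rank `≥ 4` or in case A.  NOT a proof of `θ₁₄ < 15/16`; NOT summit progress. [this work] -/
theorem second_boundary_structure_fourteen (f g : (Fin 14 → Bool) → Bool) (hf : IsDegLeFun 3 f) (hg : IsDegLeFun 3 g)
    (hΦ : (15 / 16 : ℝ) ≤ forrelation f g) (hne : forrelation f g ≠ 1) :
    ((∀ x, W (fun y => signOf (g y)) x ^ 2 = (2 : ℝ) ^ (7 + 7)) ∧ forrelation f g = 15 / 16) ∨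
    ((∀ y, W (fun x => signOf (f x)) y ^ 2 = (2 : ℝ) ^ (7 + 7)) ∧ forrelation f g = 15 / 16) ∨
    (∃ u' : (Fin (7 + 7) → Bool) → ℤ, (∀ x, W (fun y => signOf (g y)) x = (2 : ℝ) ^ 6 * (u' x : ℝ)) ∧
      4096 ≤ #(univ.filter fun x : Fin (7 + 7) → Bool => Odd (u' x)) ∧
      #(univ.filter fun x : Fin (7 + 7) → Bool => Odd (u' x)) < 8192) ∨
    (∃ v' : (Fin (7 + 7) → Bool) → ℤ, (∀ y, W (fun x => signOf (f x)) y = (2 : ℝ) ^ 6 * (v' y : ℝ)) ∧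
      4096 ≤ #(univ.filter fun y : Fin (7 + 7) → Bool => Odd (v' y)) ∧
      #(univ.filter fun y : Fin (7 + 7) → Bool => Odd (v' y)) < 8192) ∨
    (∃ u v : (Fin (7 + 7) → Bool) → ℤ, (∀ x, W (fun y => signOf (g y)) x = (2 : ℝ) ^ 5 * (u x : ℝ)) ∧
      (∀ y, W (fun x => signOf (f x)) y = (2 : ℝ) ^ 5 * (v y : ℝ)) ∧ (∀ x, Odd (u x)) ∧ (∀ y, Odd (v y)) ∧
      (#(univ.filter fun a : Fin (7 + 7) → Bool => ∀ b, (decide (Odd (u zeroVec / 2)) ^^ decide (Odd (u a / 2)) ^^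
          decide (Odd (u b / 2)) ^^ decide (Odd (u (bxor a b) / 2))) = false) < 2 ^ 12 ∨
        ∀ x, ¬ (Odd (u x / 2) ↔ Odd (u x / 2 / 2))) ∧
      (#(univ.filter fun a : Fin (7 + 7) → Bool => ∀ b, (decide (Odd (v zeroVec / 2)) ^^ decide (Odd (v a / 2)) ^^
          decide (Odd (v b / 2)) ^^ decide (Odd (v (bxor a b) / 2))) = false) < 2 ^ 12 ∨
        ∀ y, ¬ (Odd (v y / 2) ↔ Odd (v y / 2 / 2)))) :=
  fo_second_structure f g hf hg hΦ hne

end Summit.QuantumAdvantage.QuantumAdvantage.Theorems.CubicForrelation.NearExactIsExact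

end
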